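import Mathlib
import Summits.NavierStokesRegularity.NavierStokesRegularity.Theorems.QuarterLogPincerLimitSilenceDefs
import Summits.NavierStokesRegularity.NavierStokesRegularity.Theorems.QuarterLogPincerSmoothSilenceDefs
import HarnessLib

/-!
# Sc′ implies Sc″: the drift–stretch class sits inside the differential-inequality class — refuter lane ns-afl-r1

Supports crux stmt-NavierStokesRegularity-24077 (`QuarterLogPincer.TypeIQuantSubcubicExp`) via ns-idea-7's lines
`limit_silence` / `silencing_cost` (Sc′ `LimitSilence.ThickBoxSilencingCost`) and `smooth_silence` (Sc″
`SmoothSilence.DriftStretchSilencingCost`), all in the tree BY NAME.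

* `thickBox_clause_of_driftStretchBox` — a pair `(ω, v)` in the drift–stretch class `DriftStretchBox B γ σ` on
  `S × B(y,ρ)` satisfies, with the SAME constant `B`, the pointwise clause of Sc′ there: `‖ω‖ ≤ Bσ⁻²`, `‖Dω‖ ≤ Bσ⁻³`
  (the `j = 0, 1` bounds) and `‖∂ₛω − Δω‖ = ‖Dv·ω − Dω·v‖ ≤ Bσ⁻²‖ω‖ + Bσ⁻¹‖Dω‖` (the equation plus `‖Dv‖ ≤ Bσ⁻²`,
  `‖v‖ ≤ Bσ⁻¹`);
* `driftStretchSilencingCost_of_thickBoxSilencingCost : ThickBoxSilencingCost → DriftStretchSilencingCost` (Sc′ ⇒ Sc″,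
  same `K`, `c`, every `γ`).  Corollaries by composition with the landed kernel facts (not restated here, Defs-only
  imports): `ThickBoxSilencingCost → SmoothLimitStep` (with p712180 `smoothLimitStep_iff_driftStretchSilencingCost`) and
  `SmoothFailingFamily → FailingFamily` (with p710814 `failingFamily_iff_not_thickBoxSilencingCost` and p712180
  `not_driftStretchSilencingCost_of_smoothFailingFamily`).

Reading for planners/provers: Sc″ (equivalently L♯2 `SmoothLimitStep`) is the WEAKER of the two load-bearing costumes —
any proof of Sc′ (or of L1b+L2) yields it, and its failing families are failing families of the inequality class; the
converse is not claimed.  Together with the landed tightness bounds (p711856: `c ≤ 2δK³e^{−2B²/δ}` for Sc′; p711923: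
`c ≤ 5δK³e^{−2(B²/δ)^{1/5}}` for Sc″) this orders the E-chain's one open analytic statement.

HONEST FRAME: kernel bookkeeping between two stubs four levels below the crux; nothing here bears on 24077's truth, W7
or Navier–Stokes regularity (OPEN).  Refuter/instrument seat ns-afl-r1 g12, `--supports stmt-NavierStokesRegularity-24077`,
Negative lane (no Theses statement is asserted).
-/

set_option linter.dupNamespace false

namespace Summit.NavierStokesRegularity.NavierStokesRegularity.Theorems.TypeIQuantSubcubicExp.Negative.SmoothSilence

noncomputable section

open MeasureTheory Set Metric
open scoped Laplacian
open Literature.Analysis Literature.Analysis.FluidPDE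
open Summit.NavierStokesRegularity.NavierStokesRegularity.Cruxes.TypeIQuantSubcubicExp.LimitSilence
  (ThickBoxSilencingCost)
open Summit.NavierStokesRegularity.NavierStokesRegularity.Cruxes.TypeIQuantSubcubicExp.SmoothSilence
  (DriftStretchBox DriftStretchSilencingCost)

/-- **The drift–stretch class lies in the inequality class (same `B`).**  On `S × B(y,ρ)` a pair in
`DriftStretchBox B γ σ` obeys the pointwise clause of Sc′ `ThickBoxSilencingCost`. -/
theorem thickBox_clause_of_driftStretchBox {B γ σ : ℝ}
    {ω v : ℝ → (EuclideanSpace ℝ (Fin 3)) → (EuclideanSpace ℝ (Fin 3))} {y : EuclideanSpace ℝ (Fin 3)}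
    {S : Set ℝ} {ρ : ℝ} (hB : 0 ≤ B) (hσ : 0 < σ) (h : DriftStretchBox B γ σ ω v y S ρ) :
    ∀ s ∈ S, ∀ x ∈ ball y ρ,
      ‖ω s x‖ ≤ B * σ ^ (-(2 : ℝ)) ∧ ‖fderiv ℝ (ω s) x‖ ≤ B * σ ^ (-(3 : ℝ)) ∧
      ‖timeDerivWithin S ω s x - (Δ (ω s)) x‖ ≤
        B * σ ^ (-(2 : ℝ)) * ‖ω s x‖ + B * σ ^ (-(1 : ℝ)) * ‖fderiv ℝ (ω s) x‖ := by
  intro s hs x hx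
  obtain ⟨hω, hv, -, heq⟩ := h.2.2 s hs x hx
  have hω0 : ‖ω s x‖ ≤ B * σ ^ (-(2 : ℝ)) := by
    have h0 := hω 0 (by norm_num)
    rw [norm_iteratedFDeriv_zero] at h0
    simpa using h0
  have hω1 : ‖fderiv ℝ (ω s) x‖ ≤ B * σ ^ (-(3 : ℝ)) := by
    have h1 := hω 1 (by norm_num)
    rw [norm_iteratedFDeriv_one, Nat.cast_one, show (-((1 : ℝ) + 2)) = -(3 : ℝ) by norm_num] at h1
    exact h1
  have hv0 : ‖v s x‖ ≤ B * σ ^ (-(1 : ℝ)) := by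
    have h0 := hv 0 (by norm_num)
    rw [norm_iteratedFDeriv_zero] at h0
    simpa using h0
  have hv1 : ‖fderiv ℝ (v s) x‖ ≤ B * σ ^ (-(2 : ℝ)) := by
    have h1 := hv 1 (by norm_num)
    rw [norm_iteratedFDeriv_one, Nat.cast_one, show (-((1 : ℝ) + 1)) = -(2 : ℝ) by norm_num] at h1
    exact h1
  refine ⟨hω0, hω1, ?_⟩
  have hrew : timeDerivWithin S ω s x - (Δ (ω s)) x =
      fderiv ℝ (v s) x (ω s x) - fderiv ℝ (ω s) x (v s x) := by
    rw [heq]; abel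
  rw [hrew]
  have hBσ1 : 0 ≤ B * σ ^ (-(1 : ℝ)) := by positivity
  calc ‖fderiv ℝ (v s) x (ω s x) - fderiv ℝ (ω s) x (v s x)‖
      ≤ ‖fderiv ℝ (v s) x (ω s x)‖ + ‖fderiv ℝ (ω s) x (v s x)‖ := norm_sub_le _ _
    _ ≤ ‖fderiv ℝ (v s) x‖ * ‖ω s x‖ + ‖fderiv ℝ (ω s) x‖ * ‖v s x‖ :=
        add_le_add (ContinuousLinearMap.le_opNorm _ _) (ContinuousLinearMap.le_opNorm _ _)
    _ ≤ B * σ ^ (-(2 : ℝ)) * ‖ω s x‖ + ‖fderiv ℝ (ω s) x‖ * (B * σ ^ (-(1 : ℝ))) :=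
        add_le_add (mul_le_mul_of_nonneg_right hv1 (norm_nonneg _))
          (mul_le_mul_of_nonneg_left hv0 (norm_nonneg _))
    _ = B * σ ^ (-(2 : ℝ)) * ‖ω s x‖ + B * σ ^ (-(1 : ℝ)) * ‖fderiv ℝ (ω s) x‖ := by ring

/-- **Sc′ ⇒ Sc″** (same `K`, `c`; every `γ`). -/
theorem driftStretchSilencingCost_of_thickBoxSilencingCost (h : ThickBoxSilencingCost) :
    DriftStretchSilencingCost := by
  intro B γ δ Γ₂ hB _hγ hδ hΓ₂
  obtain ⟨K, c, hK, hc, hcδ, H⟩ := h B δ Γ₂ hB hδ hΓ₂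
  refine ⟨K, c, hK, hc, hcδ, fun ω v y σ t t₁ hσ htt₁ ht₁ hbox hinit => ?_⟩
  exact H ω y σ t t₁ hσ htt₁ ht₁ hbox.1 (thickBox_clause_of_driftStretchBox (by linarith) hσ hbox) hinit

end

end Summit.NavierStokesRegularity.NavierStokesRegularity.Theorems.TypeIQuantSubcubicExp.Negative.SmoothSilence
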